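import Summits.QuantumAdvantage.QuantumAdvantage.Theorems.RankDialD
import Literature.Computability.MetaComplexity.LowDegreeClosure
import HarnessLib

/-!
# RankDial (E) — part 5: the ALGEBRAIC END of the rank dial (`ExactRankBound p` PROVED for every prime `p ≠ 3`) and the
SHARP window-only quantity (the MIN-MASS law: proved at rank `ℓ/E`, dead at rank `ℓ/(p−1)`, its `ε = 0` end sandwiched)
(decomp-qadv lens-1 «grading / quantitative ladder», g26, node «OlsonDial»)

TARGET BY NAME (cell decomp-qadv, RESIDUAL MODE): item stmt-QuantumAdvantage-23109
`Summit.QuantumAdvantage.QuantumAdvantage.Theses.OddPrimeWalk.ManyReadersSqrtOdd` (=: T), reached through rung R5 =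
`AdviceFreeQNC0.WalkHardFLinSel p` (`T → ∀ p ≥ 5, R5 p`, tree `JLinPeel`; `R5 p ⟺ WindowRankLinSel p ∧ WindowHighRankLinSel p ∧
NoWindowLinSel p`, tree `RankDial.r5_iff_rank_pieces`).  This file SUPPORTS the item (`--supports`); it does not close it, and it
does not shrink the residual `WindowHighRankLinSel p ∧ NoWindowLinSel p` (both need CUT STRUCTURE; every law below is window-only
and window-only laws are DEAD above rank fraction `1/(p−1)` — `not_equiRank_block` (D), `not_massRank_block` here).

WHAT IS DECIDED HERE.
(i) Part (A) typed the qualitative end of the rank dial as the OPEN rung `RankDial.ExactRankBound p` («a `d`-row `𝔽_p`-sketch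
through which `|v| mod 3` factors exactly on `{0,1}^ℓ` has `ℓ ≤ (p−1)·d`»; UNDECIDED · INSTRUMENTABLE, machine-checked for six
`(p,d)`), tight by the block sketch (`exactRankBound_tight`).  §7–§10 PROVE it for every prime `p ≠ 3` and every `d`
(`exactRankBound_holds`), show `p ≠ 3` is necessary (`not_exactRankBound_three`), and add the one-class refinement
`PureClassBound p` («ONE weight class mod 3 is a level set of the sketch ⟹ `ℓ ≤ (p−1)d + 1`», `pureClassBound_holds`, tight at
`d = 1` by `pureClassBound_tight`, false at `p = 3`) and the collision form `exists_collision`.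
(ii) §11 types the SHARP window-only quantity, the min-mass `M(Φ) = Σ_x min_r #{v : Φv = x, |v| ≡ r (3)}` (`minMass`) and its law
`MassRank p r` («`M(Φ) ≥ 2^ℓ/C` for sketches of `≤ r(ℓ)` rows»), proves the SHARP FIBRE THEOREM `window_bound_of_massRank`
(`MassRank p r` ⟹ cut-free-window strategies of rank `≤ r(ℓ)` with ARBITRARY tables win `≤ (1 − 1/C)·2ⁿ`; per outside fibre the
losses are `≥ M(Φ)` EXACTLY because at most two classes win at each sketch value, `win_fibre_add_minMass_le`), `EquiRank ⟹ MassRank`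
(`massRank_of_equiRank`, `C = 12`; so `MassRankLin p` is PROVED for `p ≥ 5`, `massRankLin_odd`, and gives `WindowRankSel p` again,
`windowRankSel_of_massRankLin`), and the CEILING `¬ MassRank p (ℓ ↦ ℓ/(p−1))` (`not_massRank_block`: block sketches have `M = 0`).
(iii) §12 sandwiches the `ε = 0` end («`M(Φ) = 0` ⟹ `ℓ ≤ Z(p,d)`»): `Z(p,d) ≤ 2(p−1)d + 1` (`le_of_minMass_eq_zero`: two disjoint
collisions fill a fibre, `minMass_pos_append`) and `Z(p,d) ≥ (p−1)d + p` (`minMass_mixBlock_eq_zero`: `d − 1` thin blocks and one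
fat block of size `2p − 1`); at `d = 1` the two meet: `Z(p,1) = 2p − 1` DECIDED (`massZero_threshold_d1`).  Typed open rungs:
`MassRankSharp p` (the law on `(1/E, 1/(p−1))`, implied by `EquiRankSharp p`) and `MassZeroBound p` (`Z(p,d) = (p−1)d + p`).

MECHANISM of (i) (Olson's `p`-group argument run on the cube through the tree's degree filtration, no characters):
* `altSum_eq_zero_of_mem_lowDeg` — a polynomial function of degree `≤ D < n` on `{0,1}ⁿ` has alternating sum
  `Σ_b (−1)^{|b|} P(b) = 0` (the top coefficient; induction on `n` via `sliceAt_sub_sliceAt_mem_lowDeg`);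
* `fibreInd_mem_lowDeg` — the indicator of a fibre `{v : Φv = x}` of a `d`-row sketch is `Π_k (1 − (φ_k·v − x_k)^{p−1})`, of
  degree `≤ d(p−1)` (Fermat, `ind_eq_const_eq`); hence `olson_altSum`: for `ℓ > d(p−1)` EVERY fibre has as many even as odd points
  (Olson 1969: `D(ℤ_p^d) = d(p−1)+1`, here with the parity of the zero-sum subsequence read off as well);
* `altC` — the alternating sums `A_ℓ(b) = Σ_{|v| ≡ b (3)} (−1)^{|v|}` of the three weight classes obey `A_{ℓ+1}(b) = A_ℓ(b) − A_ℓ(b+2)`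
  and have the closed form `A_{2m+1} = (−3)^m·(1,−1,0)`, `A_{2m+2} = (−3)^m·(1,−2,1)` (rotated by `m`; `altC_closed`), so for `3 ≠ 0`
  some class has `A_ℓ(b) ≠ 0` (`exists_altC_ne_zero`) and at most one class has `A_ℓ(b) = 0` (`altC_zero_unique`, `ℓ ≥ 1`);
* a weight class that is a union of fibres has `A_ℓ(b) = 0` (`altC_eq_zero_of_pure`) — contradiction (`exactRankBound_holds`);
  for ONE pure class slice along a coordinate: both slices are pure classes (`b`, `b+2`) of the `(ℓ−1)`-cube (`pureClassBound_holds`).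
COROLLARY `exists_collision`: `ℓ > (p−1)d` columns `φ_j ∈ 𝔽_p^d` admit `u ≠ w ∈ {0,1}^ℓ` with `Φu = Φw` and `|u| ≢ |w| (mod 3)`
(a signed zero-sum `δ = u − w ∈ {0,±1}^ℓ` with `Σδ_j ≢ 0 mod 3`).

LADDER CONSEQUENCE (memo NODE-g26.md §1): every law of the rank dial is now decided at its natural scale, kernel on both sides —
exact factorisation flips EXACTLY at `ℓ = (p−1)d` (`exactRankBound_holds` / `exactRankBound_tight`), one pure class at
`(p−1)d + 1` (`pureClassBound_holds` / `pureClassBound_tight`), min-mass zero between `(p−1)d + p` and `2(p−1)d + 1` (`= 2p − 1` at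
`d = 1`), the min-mass LAW (hence `EquiRank`'s consequence for windows) PROVED at rank `ℓ/E` and DEAD at rank `ℓ/(p−1)`; UNDECIDED:
only the quantitative window `(1/E, 1/(p−1))` (`EquiRankSharp ⟹ MassRankSharp`) and the exact value of `Z(p,d)` for `d ≥ 2`.
-/

set_option linter.dupNamespace false
set_option autoImplicit false

noncomputable section
open Classical

namespace Summit.QuantumAdvantage.QuantumAdvantage.Theorems.RankDial

open Finset
open Summit.QuantumAdvantage.AdviceFreeQNC0
open Literature.Computability.MetaComplexity Literature.Computability.MetaComplexity.Smolensky

/-! ### §7 The alternating sum of a low-degree polynomial function on the cube -/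

section AltSum

/-- Hamming weight after prepending a `1`. -/
theorem wt_cons_true {n : ℕ} (x : Fin n → Bool) : wt (Fin.cons true x : Fin (n + 1) → Bool) = wt x + 1 := by
  unfold wt
  rw [Finset.card_filter, Finset.card_filter, Fin.sum_univ_succ]
  simp only [Fin.cons_zero, Fin.cons_succ, if_true]
  ring

/-- Hamming weight after prepending a `0`. -/
theorem wt_cons_false {n : ℕ} (x : Fin n → Bool) : wt (Fin.cons false x : Fin (n + 1) → Bool) = wt x := by
  unfold wt
  rw [Finset.card_filter, Finset.card_filter, Fin.sum_univ_succ]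
  simp only [Fin.cons_zero, Fin.cons_succ, Bool.false_eq_true, if_false, zero_add]

/-- Splitting a sum over the `(n+1)`-cube along the first coordinate. -/
theorem sum_cube_succ {M : Type*} [AddCommMonoid M] {n : ℕ} (f : (Fin (n + 1) → Bool) → M) :
    ∑ b, f b = ∑ x : Fin n → Bool, f (Fin.cons true x) + ∑ x : Fin n → Bool, f (Fin.cons false x) := by
  have h := Fintype.sum_equiv (Fin.consEquiv fun _ => Bool) (fun q => f (Fin.cons q.1 q.2)) f (fun _ => rfl)
  rw [← h, Fintype.sum_prod_type]
  simp only [Fintype.sum_bool]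

/-- Pointwise formula for the slice `σ_c` (tree `sliceAt`; its `simp` lemma there is private). -/
theorem sliceAt_apply' {F : Type*} [Field F] {n : ℕ} (c : Bool) (P : CubeFn F (n + 1)) (x : Fin n → Bool) :
    sliceAt F c P x = P (Fin.cons c x) :=
  rfl

/-- **The top coefficient vanishes.**  A polynomial function of degree `≤ D` on `{0,1}ⁿ` with `D < n` has alternating
sum zero: `Σ_b (−1)^{|b|} P(b) = 0` (the sum is `±` the coefficient of `x₁⋯xₙ`).  Induction on `n`: the sum over the
`(n+1)`-cube is minus the sum of `(−1)^{|x|}·(σ₁P − σ₀P)(x)` over the `n`-cube, and `σ₁P − σ₀P` has degree `≤ D − 1`. -/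
theorem altSum_eq_zero_of_mem_lowDeg {F : Type*} [Field F] {n : ℕ} :
    ∀ {D : ℕ} {P : CubeFn F n}, P ∈ lowDeg F n D → D < n → ∑ b : Fin n → Bool, (-1 : F) ^ wt b * P b = 0 := by
  induction n with
  | zero =>
    intro D P _ hD
    exact absurd hD (Nat.not_lt_zero D)
  | succ n ih =>
    intro D P hP hD
    have hx : ∀ x : Fin n → Bool,
        (-1 : F) ^ wt (Fin.cons true x : Fin (n + 1) → Bool) * P (Fin.cons true x) +
          (-1 : F) ^ wt (Fin.cons false x : Fin (n + 1) → Bool) * P (Fin.cons false x) =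
        -((-1 : F) ^ wt x * (sliceAt F true P - sliceAt F false P) x) := by
      intro x
      rw [wt_cons_true, wt_cons_false, Pi.sub_apply, sliceAt_apply', sliceAt_apply', pow_succ]
      ring
    rw [sum_cube_succ, ← Finset.sum_add_distrib, Finset.sum_congr rfl (fun x _ => hx x), Finset.sum_neg_distrib,
      neg_eq_zero]
    cases D with
    | zero =>
      refine Finset.sum_eq_zero fun x _ => ?_
      have h1 := congrFun (eq_const_of_mem_lowDeg_zero hP (Fin.cons true x)) (Fin.cons false x)
      simp only [Pi.smul_apply, Pi.one_apply, smul_eq_mul, mul_one] at h1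
      rw [Pi.sub_apply, sliceAt_apply', sliceAt_apply', h1, sub_self, mul_zero]
    | succ D =>
      exact ih (sliceAt_sub_sliceAt_mem_lowDeg hP) (by omega)

/-- In particular the whole cube (`P = 1`, `n ≥ 1`): `Σ_b (−1)^{|b|} = 0`. -/
theorem altSum_cube_eq_zero {F : Type*} [Field F] {n : ℕ} (hn : 0 < n) :
    ∑ b : Fin n → Bool, (-1 : F) ^ wt b = 0 := by
  have h := altSum_eq_zero_of_mem_lowDeg (one_mem_lowDeg (F := F) (n := n) 0) hn
  simpa only [Pi.one_apply, mul_one] using h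

end AltSum

/-! ### §8 Olson's theorem on the cube: fibres of a low-rank sketch are parity-balanced -/

/-- The sketch map `v ↦ Φv ∈ 𝔽_p^d` of a `d`-row sketch `Φ ∈ 𝔽_p^{d×ℓ}` on the `ℓ`-cube (the tree's
`fun k => ∑ j, if v j then Φ k j else 0`, named). -/
def skt {p d ℓ : ℕ} (Φ : Fin d → Fin ℓ → ZMod p) (v : Fin ℓ → Bool) : Fin d → ZMod p :=
  fun k => ∑ j, if v j then Φ k j else 0

section Olson
variable {p : ℕ} [Fact p.Prime]

/-- The indicator of a level set of one linear form has degree `≤ p − 1` (Fermat; cf. tree `hasDegF_linTest`). -/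
theorem linInd_mem_lowDeg {ℓ : ℕ} (lam : Fin ℓ → ZMod p) (r : ZMod p) :
    (fun v : Fin ℓ → Bool => if (∑ j, if v j then lam j else 0) = r then (1 : ZMod p) else 0) ∈
      lowDeg (ZMod p) ℓ (p - 1) := by
  have heq : (fun v : Fin ℓ → Bool => if (∑ j, if v j then lam j else 0) = r then (1 : ZMod p) else 0) =
      1 - ((fun v : Fin ℓ → Bool => ∑ j, (if v j then lam j else 0)) - fun _ => r) ^ (p - 1) := by
    funext v
    simp only [Pi.sub_apply, Pi.pow_apply, Pi.one_apply]
    exact ind_eq_const_eq _ r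
  rw [heq]
  have hconst : (fun _ : Fin ℓ → Bool => r) ∈ lowDeg (ZMod p) ℓ 1 := by
    have : (fun _ : Fin ℓ → Bool => r) = r • (1 : CubeFn (ZMod p) ℓ) := by
      funext u; simp
    rw [this]
    exact Submodule.smul_mem _ _ (one_mem_lowDeg 1)
  have h1 : ((fun v : Fin ℓ → Bool => ∑ j, (if v j then lam j else 0)) - fun _ => r) ∈ lowDeg (ZMod p) ℓ 1 :=
    Submodule.sub_mem _ (linForm_mem_lowDeg lam) hconst
  have hpow := pow_mem_lowDeg h1 (p - 1)
  rw [Nat.mul_one] at hpow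
  exact Submodule.sub_mem _ (one_mem_lowDeg _) hpow

/-- **The fibre indicator has degree `≤ d(p−1)`**: `[Φv = x] = Π_k (1 − (φ_k·v − x_k)^{p−1})`. -/
theorem fibreInd_mem_lowDeg {d ℓ : ℕ} (Φ : Fin d → Fin ℓ → ZMod p) (x : Fin d → ZMod p) :
    (fun v : Fin ℓ → Bool => if skt Φ v = x then (1 : ZMod p) else 0) ∈ lowDeg (ZMod p) ℓ (d * (p - 1)) := by
  have heq : (fun v : Fin ℓ → Bool => if skt Φ v = x then (1 : ZMod p) else 0) =
      ∏ k : Fin d, fun v : Fin ℓ → Bool => if (∑ j, if v j then Φ k j else 0) = x k then (1 : ZMod p) else 0 := by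
    funext v
    rw [Finset.prod_apply, Fintype.prod_boole]
    by_cases h : skt Φ v = x
    · rw [if_pos h, if_pos (show ∀ k, (∑ j, if v j then Φ k j else 0) = x k from fun k => congrFun h k)]
    · rw [if_neg h, if_neg (show ¬ ∀ k, (∑ j, if v j then Φ k j else 0) = x k from fun h' => h (funext h'))]
  rw [heq]
  have h := prod_mem_lowDeg (univ : Finset (Fin d)) (fun k _ => linInd_mem_lowDeg (Φ k) (x k))
  rwa [Finset.card_univ, Fintype.card_fin] at h

/-- **Olson on the cube.**  If `ℓ > d(p−1)` then every fibre `{v ∈ {0,1}^ℓ : Φv = x}` of a `d`-row `𝔽_p`-sketch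
has alternating sum `Σ (−1)^{|v|} = 0` in `𝔽_p` — as many even-weight as odd-weight points modulo `p`; for `x = 0` and
`v ≠ 0` this is Olson's theorem `D(ℤ_p^d) ≤ d(p−1)+1` with the parity refinement. -/
theorem olson_altSum {d ℓ : ℕ} (hℓ : d * (p - 1) < ℓ) (Φ : Fin d → Fin ℓ → ZMod p) (x : Fin d → ZMod p) :
    ∑ v ∈ univ.filter (fun v : Fin ℓ → Bool => skt Φ v = x), (-1 : ZMod p) ^ wt v = 0 := by
  have h := altSum_eq_zero_of_mem_lowDeg (fibreInd_mem_lowDeg Φ x) hℓ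
  rw [Finset.sum_filter]
  simpa only [mul_ite, mul_one, mul_zero] using h

end Olson

end Summit.QuantumAdvantage.QuantumAdvantage.Theorems.RankDial

end
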